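import Mathlib
import Summits.NavierStokesRegularity.FluidComputer.TransportSobolevSelfAdvection
import Summits.NavierStokesRegularity.FluidComputer.TransportGalerkinWeights
import Summits.NavierStokesRegularity.FluidComputer.TransportGalerkinBox
import Summits.NavierStokesRegularity.FluidComputer.TransportGalerkinOneSided
import HarnessLib

/-!
# Galerkin limit of the transport model, VIII: the order-`σ` energy along a Galerkin level (instab g19, cell `ns-blowup`, 2026-08-27)

HONEST FRAMING (human ruling D-0035): nothing here is a claim about Navier–Stokes blow-up.
WHAT THIS IS NOT: not NS evidence — calculus bookkeeping on the scaled phase space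
`E = lp (ℤ^d → V) 2` of the R-β chain (`TransportGalerkinDefs`): a diagonal weight, its derivative
along a trajectory, and the identification of that derivative with the lattice pairing bounded in
part VII (`TransportSobolevSelfAdvection.two_re_pairing_field_le`). No flow is constructed; the
Galerkin trajectory is a hypothesis.

PURPOSE. RESIDENCE (β3) of the R-β chain for `ν > 0` from the bootstrap's `H²` bound
(`HOME/instab/BETA2-SPEC.md` §6, INSTAB-BRIDGE l.135). For a level-`N` Galerkin trajectory
`y : ℝ → E` of `y' = P_N F(y)` (`F = nsField ν Uv π P`, `P_N = cubeProj N`) whose values are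
`P_N`-fixed and satisfy the three linear clauses of `TransportGalerkin.box` (Leray-fixed, real,
divergence-free through `π`), the order-`σ` energy of the UNSCALED family `û = Λ⁻² ⇑y`,

  `S_σ(t) = ‖Λ⁻² ⇑(y t)‖_σ² = Re ⟪D_σ (y t), y t⟫`   (`D_σ` = the diagonal weight `𝟙_{cube N} ⟨k⟩^{2σ−4}`),

has right derivative `2 Re ⟪D_σ (y t), P_N F(y t)⟫ = 2 Re ⟨Λ^σ P(lin û + bil(û, û)), Λ^σ û⟩` (§2–§3),
hence (§4, `hasDerivWithinAt_energy_le`) obeys part VII's differential inequality with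
level-INDEPENDENT constants. Part IX (`TransportGalerkinResidence`) integrates it.

* §1 `exists_levelWeight` — the bounded diagonal weight `D_σ` and `Re⟪D_σ x, x⟫ = ‖Λ⁻² ⇑x‖_σ²` on
  `range P_N`;
* §2 `hasDerivWithinAt_re_inner_diag` — `d/dt Re⟪D y, y⟫ = 2 Re⟪D y, y'⟫` for a symmetric `D`;
* §3 `re_inner_diag_nsField_eq` — `Re⟪D_σ x, P_N F x⟫ = Re ⟨Λ^σ P(lin û + bil(û,û)), Λ^σ û⟩`;
* §4 `hasDerivWithinAt_energy_le` — the differential inequality along the trajectory.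
-/

noncomputable section

open scoped ENNReal NNReal ComplexConjugate InnerProductSpace
open Set Filter Topology

namespace Summit.NavierStokesRegularity.FluidComputer.TransportGalerkinEnergyLevel

open Finset RCLike
open Literature.Analysis.FunctionSpaces Literature.Analysis.FunctionSpaces.Lattice
open Literature.Analysis.FunctionSpaces.Torus
open Literature.Analysis.ODE
open Summit.NavierStokesRegularity.FluidComputer.GalerkinLatticePhaseSpace
open Summit.NavierStokesRegularity.FluidComputer.TransportGalerkin
open Summit.NavierStokesRegularity.FluidComputer.TransportGalerkinRapid
open Summit.NavierStokesRegularity.FluidComputer.TransportGalerkinBox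
open Summit.NavierStokesRegularity.FluidComputer.TransportGalerkinWeights
open Summit.NavierStokesRegularity.FluidComputer.TransportSobolevSelfAdvection
open Summit.NavierStokesRegularity.FluidComputer.TransportGalerkinOneSided

variable {d : Type*} [Fintype d] [DecidableEq d]
variable {V : Type*} [NormedAddCommGroup V] [InnerProductSpace ℂ V] [CompleteSpace V]

/-! ## §1 The level weight `D_σ = 𝟙_{cube N} ⟨k⟩^{2σ−4}` -/

section Weight

/-- The symbol of the level weight: `⟨k⟩^{2s}` on the cube `|k|_∞ ≤ N` (for the unscaled order
`s + 2`), `0` off it. -/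
theorem levelSymbol_bound (s : ℝ) (N : ℕ) :
    ∃ M : ℝ, ∀ k : d → ℤ,
      |(if k ∈ Fintype.piFinset (fun _ : d => Finset.Icc (-(N : ℤ)) N)
        then sobolevWeight s k ^ 2 else 0)| ≤ M := by
  classical
  set K := Fintype.piFinset (fun _ : d => Finset.Icc (-(N : ℤ)) N) with hK
  obtain ⟨M, hM⟩ := Finset.exists_le (K.image fun k => sobolevWeight s k ^ 2)
  refine ⟨max M 0, fun k => ?_⟩
  split_ifs with hk
  · rw [abs_of_nonneg (sq_nonneg _)]
    exact (hM _ (Finset.mem_image_of_mem _ hk)).trans (le_max_left _ _)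
  · simp

omit [CompleteSpace V] in
/-- **The level weight.** For every real `s` and level `N` there is a bounded real-linear diagonal
operator `D` on `E` with symbol `𝟙_{cube N}(k) ⟨k⟩^{2s}` (`TransportGalerkinWeights.exists_diagCLM`). -/
theorem exists_levelWeight (s : ℝ) (N : ℕ) :
    ∃ D : lp (fun _ : (d → ℤ) => V) 2 →L[ℝ] lp (fun _ : (d → ℤ) => V) 2, ∀ z : lp (fun _ : (d → ℤ) => V) 2, ⇑(D z) = fun k =>
      ((if k ∈ Fintype.piFinset (fun _ : d => Finset.Icc (-(N : ℤ)) N)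
        then sobolevWeight s k ^ 2 else 0 : ℝ) : ℂ) • z k := by
  obtain ⟨M, hM⟩ := levelSymbol_bound (d := d) s N
  exact exists_diagCLM (V := V) hM

omit [CompleteSpace V] in
/-- **The level weight computes the order-`s` energy on `range P_N`**: if `P_N x = x` then
`Re ⟪D x, x⟫ = ‖⇑x‖_s²` (`= (eNormSq s ⇑x).toReal`; all sums are finite). -/
theorem re_inner_levelWeight_self {s : ℝ} {N : ℕ} {D : lp (fun _ : (d → ℤ) => V) 2 →L[ℝ] lp (fun _ : (d → ℤ) => V) 2}
    (hD : ∀ z : lp (fun _ : (d → ℤ) => V) 2, ⇑(D z) = fun k =>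
      ((if k ∈ Fintype.piFinset (fun _ : d => Finset.Icc (-(N : ℤ)) N)
        then sobolevWeight s k ^ 2 else 0 : ℝ) : ℂ) • z k)
    {x : lp (fun _ : (d → ℤ) => V) 2} (hx : cubeProj N x = x) :
    re ⟪D x, x⟫_ℂ = (eNormSq s (⇑x)).toReal := by
  classical
  obtain ⟨M, hM⟩ := levelSymbol_bound (d := d) s N
  have h := re_inner_diag_self_eq_tsum hD hM x
  rw [h, eNormSq,
    ENNReal.tsum_toReal_eq fun k => ENNReal.mul_ne_top ENNReal.ofReal_ne_top
      (ENNReal.pow_ne_top enorm_ne_top)]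
  refine tsum_congr fun k => ?_
  have hxk : (x : (d → ℤ) → V) k =
      if k ∈ Fintype.piFinset (fun _ : d => Finset.Icc (-(N : ℤ)) N) then (x : (d → ℤ) → V) k else 0 := by
    conv_lhs => rw [← hx]
    exact cubeProj_apply N x k
  split_ifs with hk
  · rw [ENNReal.toReal_mul, ENNReal.toReal_ofReal (sq_nonneg _), ← ofReal_norm,
      ← ENNReal.ofReal_pow (norm_nonneg _), ENNReal.toReal_ofReal (sq_nonneg _)]
  · rw [hxk, if_neg hk]; simp

end Weight

/-! ## §2 Derivative of a symmetric quadratic form along a trajectory -/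

section Deriv

omit [Fintype d] [DecidableEq d] [CompleteSpace V] in
/-- **`d/dt Re⟪D y, y⟫ = 2 Re⟪D y, y'⟫`** within any set, for a bounded real-linear `D` that is
symmetric for the complex inner product. -/
theorem hasDerivWithinAt_re_inner_diag {D : lp (fun _ : (d → ℤ) => V) 2 →L[ℝ] lp (fun _ : (d → ℤ) => V) 2} (hsymm : ∀ x y : lp (fun _ : (d → ℤ) => V) 2, ⟪D x, y⟫_ℂ = ⟪x, D y⟫_ℂ)
    {y : ℝ → lp (fun _ : (d → ℤ) => V) 2} {y' : lp (fun _ : (d → ℤ) => V) 2} {S : Set ℝ} {t : ℝ}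
    (hy : HasDerivWithinAt y y' S t) :
    HasDerivWithinAt (fun τ => re ⟪D (y τ), y τ⟫_ℂ) (2 * re ⟪D (y t), y'⟫_ℂ) S t := by
  have hDy : HasDerivWithinAt (fun τ => D (y τ)) (D y') S t :=
    D.hasFDerivAt.comp_hasDerivWithinAt t hy
  have hinner : HasDerivWithinAt (fun τ => ⟪D (y τ), y τ⟫_ℂ) (⟪D (y t), y'⟫_ℂ + ⟪D y', y t⟫_ℂ) S t :=
    hDy.inner ℂ hy
  have hre : HasDerivWithinAt (fun τ => re ⟪D (y τ), y τ⟫_ℂ)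
      (RCLike.reCLM (⟪D (y t), y'⟫_ℂ + ⟪D y', y t⟫_ℂ)) S t :=
    (RCLike.reCLM (K := ℂ)).hasFDerivAt.comp_hasDerivWithinAt t hinner
  refine hre.congr_deriv ?_
  rw [RCLike.reCLM_apply, map_add, hsymm y' (y t), ← inner_conj_symm (y'), RCLike.conj_re]
  ring

end Deriv

/-! ## §3 The derivative pairs against the lattice field of part VII -/

section Identify

variable {ν : ℝ} {Uv : (d → ℤ) → V} {π : d → (V →L[ℂ] ℂ)} {P : (d → ℤ) → (V →L[ℂ] V)}

omit [CompleteSpace V] in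
/-- A `P_N`-fixed element vanishes off the cube, and so does its unscaled family. -/
theorem apply_eq_zero_of_not_mem {N : ℕ} {x : lp (fun _ : (d → ℤ) => V) 2} (hx : cubeProj N x = x) {k : d → ℤ}
    (hk : k ∉ Fintype.piFinset (fun _ : d => Finset.Icc (-(N : ℤ)) N)) :
    (x : (d → ℤ) → V) k = 0 := by
  have h := cubeProj_apply N x k
  rw [hx, if_neg hk] at h
  exact h

/-- **`Re⟪D_σ x, P_N F x⟫` is the lattice pairing of part VII**: for a `P_N`-fixed `x ∈ E` (so
`û = Λ⁻² ⇑x` is finitely supported) and the level weight `D_σ` of order `σ` (symbol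
`𝟙_{cube N}⟨k⟩^{2(σ−2)}` on the scaled family),

  `⟪D_σ x, P_N (nsField ν Uv π P x)⟫ = conj ⟨Λ^σ P(linCoeff û + bilCoeff û û), Λ^σ û⟩`,

hence the real parts agree. (`P_N` is invisible because `D_σ x` lives on the cube; the two `Λ²`
of the scaled coordinates and the `⟨k⟩^{2σ−4}` of the symbol make `⟨k⟩^{2σ}`.) -/
theorem inner_levelWeight_nsField_eq (hUv : RapidDecay Uv) (hP : ∀ k, ‖P k‖ ≤ 1)
    {σ : ℝ} {N : ℕ} {D : lp (fun _ : (d → ℤ) => V) 2 →L[ℝ] lp (fun _ : (d → ℤ) => V) 2}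
    (hD : ∀ z : lp (fun _ : (d → ℤ) => V) 2, ⇑(D z) = fun k =>
      ((if k ∈ Fintype.piFinset (fun _ : d => Finset.Icc (-(N : ℤ)) N)
        then sobolevWeight (σ - 2) k ^ 2 else 0 : ℝ) : ℂ) • z k)
    {x : lp (fun _ : (d → ℤ) => V) 2} (hx : cubeProj N x = x) :
    ⟪D x, cubeProj N (nsField ν Uv π P x)⟫_ℂ =
      conj (pairing (wmul σ (fun k => P k (linCoeff ν Uv π (wmul (-2) ⇑x) k
        + bilCoeff π (wmul (-2) ⇑x) (wmul (-2) ⇑x) k))) (wmul σ (wmul (-2) ⇑x))) := by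
  classical
  set K := Fintype.piFinset (fun _ : d => Finset.Icc (-(N : ℤ)) N) with hK
  set û : (d → ℤ) → V := wmul (-2) ⇑x with hû
  set f : (d → ℤ) → V := fun k => P k (linCoeff ν Uv π û k + bilCoeff π û û k) with hf
  have hxr : RapidDecay (⇑x) := by rw [← hx]; exact rapidDecay_coe_cubeProj N x
  -- coefficients of the field
  have hcoe : ⇑(nsField ν Uv π P x) = wmul 2 f := by
    rw [nsField_eq, lp.coeFn_add, coe_linOp_of_rapidDecay hUv hP hxr, coe_bilOp_of_rapidDecay hP hxr hxr]
    funext k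
    simp only [Pi.add_apply, wmul_apply, hf, hû, map_add, smul_add]
  rw [← pairing_comm, inner_diag_eq_tsum hD]
  unfold pairing
  refine tsum_congr fun k => ?_
  by_cases hk : k ∈ K
  · have hPz : (cubeProj N (nsField ν Uv π P x) : (d → ℤ) → V) k = wmul 2 f k := by
      rw [cubeProj_apply, if_pos hk, hcoe]
    have hxk : (x : (d → ℤ) → V) k = ((sobolevWeight 2 k : ℝ) : ℂ) • û k := by
      rw [hû, ← wmul_apply, wmul_two_wmul_neg_two]
    rw [if_pos hk, hPz, hxk, wmul_apply, wmul_apply, wmul_apply, inner_smul_left, inner_smul_right,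
      inner_smul_left, inner_smul_right, Complex.conj_ofReal, Complex.conj_ofReal]
    have hw : sobolevWeight (σ - 2) k ^ 2 * (sobolevWeight 2 k * sobolevWeight 2 k) =
        sobolevWeight σ k * sobolevWeight σ k := by
      have h1 : sobolevWeight σ k = sobolevWeight (σ - 2) k * sobolevWeight 2 k := by
        rw [← sobolevWeight_add]; ring_nf
      rw [h1]; ring
    have hw' := congrArg (fun r : ℝ => (r : ℂ)) hw
    push_cast at hw' ⊢
    linear_combination (⟪û k, f k⟫_ℂ) * hw'
  · have hx0 : (x : (d → ℤ) → V) k = 0 := apply_eq_zero_of_not_mem hx hk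
    have hû0 : û k = 0 := by rw [hû, wmul_apply, hx0, smul_zero]
    rw [if_neg hk, wmul_apply, hû0, smul_zero, inner_zero_left]
    simp

/-- Real parts: `Re⟪D_σ x, P_N F x⟫ = Re ⟨Λ^σ P(lin û + bil(û, û)), Λ^σ û⟩`. -/
theorem re_inner_levelWeight_nsField_eq (hUv : RapidDecay Uv) (hP : ∀ k, ‖P k‖ ≤ 1)
    {σ : ℝ} {N : ℕ} {D : lp (fun _ : (d → ℤ) => V) 2 →L[ℝ] lp (fun _ : (d → ℤ) => V) 2}
    (hD : ∀ z : lp (fun _ : (d → ℤ) => V) 2, ⇑(D z) = fun k =>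
      ((if k ∈ Fintype.piFinset (fun _ : d => Finset.Icc (-(N : ℤ)) N)
        then sobolevWeight (σ - 2) k ^ 2 else 0 : ℝ) : ℂ) • z k)
    {x : lp (fun _ : (d → ℤ) => V) 2} (hx : cubeProj N x = x) :
    re ⟪D x, cubeProj N (nsField ν Uv π P x)⟫_ℂ =
      (pairing (wmul σ (fun k => P k (linCoeff ν Uv π (wmul (-2) ⇑x) k
        + bilCoeff π (wmul (-2) ⇑x) (wmul (-2) ⇑x) k))) (wmul σ (wmul (-2) ⇑x))).re := by
  rw [inner_levelWeight_nsField_eq hUv hP hD hx, RCLike.conj_re, RCLike.re_to_complex]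

end Identify

/-! ## §4 The differential inequality along a Galerkin level -/

section Trajectory

variable {ν : ℝ} {Uv : (d → ℤ) → V} {π : d → (V →L[ℂ] ℂ)} {P : (d → ℤ) → (V →L[ℂ] V)}
  {ρ : (d → ℤ) → ℝ}

omit [DecidableEq d] [CompleteSpace V] in
/-- The unscaled family of a box element is `P`-fixed. -/
theorem unscale_fix {x : lp (fun _ : (d → ℤ) => V) 2} (hxW : x ∈ box ρ π P) (k : d → ℤ) :
    P k (wmul (-2) (⇑x) k) = wmul (-2) (⇑x) k := by
  rw [wmul_apply, map_smul, hxW.2.1 k]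

/-- **The order-`σ` differential inequality at a point of a Galerkin level** (`σ ∈ ℕ`, `σ ≥ 1`):
for a `P_N`-fixed `x ∈ W = box ρ π P` (any radii — only the three linear clauses are used), with
`û = Λ⁻² ⇑x`, `S_s = ‖û‖_s²`, `A₁(û) = ∑_p ⟨p⟩‖û p‖` and the level weight `D_σ`,

  `2 Re⟪D_σ x, P_N F x⟫ ≤ −2ν(2π)²(S_{σ+1} − S_σ) + 2(H₁ + H₂ + K_σ A₁(û)) S_σ`

with the host constants of part VI/VII (`TransportSobolevSelfAdvection.two_re_pairing_field_le`). -/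
theorem two_re_inner_levelWeight_nsField_le (hUv : RapidDecay Uv) (hπ : ∀ j, ‖π j‖ ≤ 1)
    (hUreal : ∀ j p, π j (Uv (-p)) = conj (π j (Uv p)))
    (hUdiv : ∑ j, freqDeriv j (fun p => π j (Uv p)) = 0)
    (hPsa : ∀ k, IsSelfAdjoint (P k)) (hP : ∀ k, ‖P k‖ ≤ 1)
    {σ : ℕ} (hσ : 1 ≤ σ) {N : ℕ} {D : lp (fun _ : (d → ℤ) => V) 2 →L[ℝ] lp (fun _ : (d → ℤ) => V) 2}
    (hD : ∀ z : lp (fun _ : (d → ℤ) => V) 2, ⇑(D z) = fun k =>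
      ((if k ∈ Fintype.piFinset (fun _ : d => Finset.Icc (-(N : ℤ)) N)
        then sobolevWeight ((σ : ℝ) - 2) k ^ 2 else 0 : ℝ) : ℂ) • z k)
    {x : lp (fun _ : (d → ℤ) => V) 2} (hx : cubeProj N x = x) (hxW : x ∈ box ρ π P) :
    2 * re ⟪D x, cubeProj N (nsField ν Uv π P x)⟫_ℂ ≤
      -(2 * ν * (2 * Real.pi) ^ 2 *
          ((eNormSq ((σ : ℝ) + 1) (wmul (-2) ⇑x)).toReal - (eNormSq (σ : ℝ) (wmul (-2) ⇑x)).toReal))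
      + 2 * ((σ * (2 : ℝ) ^ σ) * (2 * Real.pi) *
              (∑ j, (symbNorm (σ : ℝ) (scal (fun p => π j (Uv p)) : (d → ℤ) → (V →L[ℂ] V))).toReal)
            + (2 : ℝ) ^ ((σ : ℝ) / 2) * ((Fintype.card d : ℝ) * (2 * Real.pi)) *
              (∑' l, ENNReal.ofReal (sobolevWeight ((σ : ℝ) + 1) l) * ‖Uv l‖ₑ).toReal
            + (Fintype.card d : ℝ) * (σ * (2 : ℝ) ^ σ) * (2 * Real.pi) *
              (∑' l, ENNReal.ofReal (sobolevWeight 1 l) * ‖wmul (-2) (⇑x) l‖ₑ).toReal) *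
          (eNormSq (σ : ℝ) (wmul (-2) ⇑x)).toReal := by
  have hxr : RapidDecay (⇑x) := by rw [← hx]; exact rapidDecay_coe_cubeProj N x
  have hûr : RapidDecay (wmul (-2) (⇑x)) := rapidDecay_wmul hxr (-2)
  rw [re_inner_levelWeight_nsField_eq hUv hP hD hx]
  exact two_re_pairing_field_le ν hUv π hπ hUreal hUdiv P hPsa hûr (unscale_fix hxW)
    (comp_unscale_real hxW) (comp_unscale_div hxW) hσ

omit [CompleteSpace V] in
/-- **The order-`σ` energy is differentiable along a trajectory**, with derivative
`2 Re⟪D_σ (y t), y'⟫` (the level weight is symmetric: `TransportGalerkinWeights.diag_symm`). Combined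
with `two_re_inner_levelWeight_nsField_le` at `y' = P_N F(y t)` and with
`re_inner_levelWeight_self` (`Re⟪D_σ y, y⟫ = ‖Λ⁻² ⇑y‖_σ²` on `range P_N`) this is the differential
inequality that part IX integrates. -/
theorem hasDerivWithinAt_levelEnergy {σ : ℝ} {N : ℕ} {D : lp (fun _ : (d → ℤ) => V) 2 →L[ℝ] lp (fun _ : (d → ℤ) => V) 2}
    (hD : ∀ z : lp (fun _ : (d → ℤ) => V) 2, ⇑(D z) = fun k =>
      ((if k ∈ Fintype.piFinset (fun _ : d => Finset.Icc (-(N : ℤ)) N)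
        then sobolevWeight σ k ^ 2 else 0 : ℝ) : ℂ) • z k)
    {y : ℝ → lp (fun _ : (d → ℤ) => V) 2} {y' : lp (fun _ : (d → ℤ) => V) 2} {S : Set ℝ} {t : ℝ} (hy : HasDerivWithinAt y y' S t) :
    HasDerivWithinAt (fun τ => re ⟪D (y τ), y τ⟫_ℂ) (2 * re ⟪D (y t), y'⟫_ℂ) S t :=
  hasDerivWithinAt_re_inner_diag (diag_symm hD) hy

end Trajectory


end Summit.NavierStokesRegularity.FluidComputer.TransportGalerkinEnergyLevel

end
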